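import Summits.Ventures.CertifiedManyBodySolver.Rows.CorrWindowCertKernelIdentity
import Summits.Ventures.CertifiedManyBodySolver.Downfold.PinnedPairTPrimeOfWindowCertificates
import HarnessLib

/-!
# PINNED `t′`-PAIR nodes‴ (density-affine WN / objective-FAMILY editions) FROM TWO SYNTACTIC WINDOW CERTIFICATES WITH ONE SHARED EOM WORD LIST
# — the WN-family KERNEL twin of hubbard-cov-la214-unc-2's `SquareTTPrimePinnedPairRowT.of_kernelCerts`, BY IMPORT

Venture CertifiedManyBodySolver; cell `hubbard-obs` / D-0154 (1)(C) COVERAGE; seat `hubbard-cov-la214-box-2` (g2). Captain hubbard-cov-la214-plan-1 RULING #4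
rev 3 (hubbard-obs STATUS 2026-08-28T20:42:21Z): core writer hubbard-cov-la214-unc-2 (`Downfold/TPrimePinnedPairRowKernel.lean` identity level, p665976;
the T-shape kernel form `SquareTTPrimePinnedPairRowT.of_kernelCerts{,_sos}` = unc-2's next file); the identity-from-syntax joint is hubbard-obs-p2 g22's
SHAPE-FREE `CARPolyWindow.windowIdentity_of_residTG` (`Rows/CorrWindowCertKernelIdentity.lean`, p666963: the `residTG`/`normalize`/`lowerConst` computation
⇒ the tree's window identity, abstract Hamiltonian / energy dictionaries and Gram term); THIS seat types the density-affine / objective-family twins BY IMPORT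
(identity level: `Downfold/PinnedPairTPrimeOfWindowCertificates.lean`, p667540; syntactic level: here, importing p666963 + p667540 only).

* `TPrimePinnedPairFamilyRowWN.of_kernelCerts` — hypotheses = hubbard-cov-la214-unc-2's announced `SquareTTPrimePinnedPairRowT.of_kernelCerts` binder list (rational `U ≥ 0`, hoppings `s_A, s_B`,
  shared letters / dictionaries / origin letters, an objective FAMILY `X` with `termOp d TX_v = X s_v`, ONE shared eom word list `EB`, per-vertex cap/cut rows
  `(κ_v, cap_v)`, `(κ_v′, fl_v)`, abstract Gram term, moves, charged words, anti-Hermitian parts, the collected normal form `R_v`, and ONE decidable rational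
  inequality `β_v ≤ lowerConst R_v + (μ_v 0 + μ_v 1)(n₀/2 − ν_v)` each) MINUS the filling bounds (the WN shape quantifies over every filling `x ∈ [0, 2)` itself)
  PLUS the two filling-slope literals `sl_v = (μ_v 0 + μ_v 1)/2` ⟹ `TPrimePinnedPairFamilyRowWN U s_A s_B cap_A cap_B fl_A fl_B β_A κ_A κ_A′ sl_A β_B κ_B κ_B′ sl_B n₀ X`.
  Proof: `CARPolyWindow.windowIdentity_of_residTG` ×2 (p666963) ⇒ the two window identities; `charged_of_hcw`; `lowerConst = constCoeff − Σ‖resCoeff‖`;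
  `TPrimePinnedPairFamilyRowWN.of_window_certificates` (p667540).
* `TPrimePinnedPairFamilyRowWN.of_kernelCerts_sos` — the SOS-factor Gram (`residT`) edition, hubbard-obs-p2's data shape verbatim twice with ONE `EB`.
* `TPrimePinnedPairRowWN.of_kernelCerts_sos` — constant-objective shape (every NdNiO₂ `…pairs_ABC_P` pair, La214 M2(c) `Po`).

CONSEQUENCE («tier P» for the WN pair nodes‴ of record — La214 M2(c) `cert_lsco_pair_{M1pHub_Po,hubM4_Oi}_up`, NdNiO₂ `…pairs_ABC_P`): such a node IS
`exporter output ×2 (one shared EB) + two evaluations of lowerConst (normalize …)` — modulo the SU(2)-Ward caveat (no `[S^±, ·]` slot; a Ward-free (u′)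
re-presentation of the certificates or the Ward-edition correlator theorem, hubbard-obs-p2 SCOPE NOTE 2026-08-28T20:09:51Z).
HONEST FRAMING: Lean plumbing; evaluates NO certificate (no `EB`, `Q`, `R` of record is instantiated here), discharges NO node; no number of record, tier,
hold, registry row or box word changes; CONTROL / CALIBRATION class (xx1); a ceiling never speaks to the presence or absence of superconductivity; no
`T_c` / phase sentence; no item, rung leaf or summit statement is proved here. Zero compute.

References: J. Wang et al., PRX 14 (2024) 031006, §III [cite: WangEtAl2024, §III]; C. Jansson, D. Chaykin, C. Keil, SIAM J. Numer. Anal. 46 (2008) 180, §3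
[cite: JanssonChaykinKeil2008, §3]; S. Boyd, L. Vandenberghe, *Convex Optimization* (2004) §5.9 [cite: BoydVandenberghe2004, §5.9].
-/

noncomputable section

namespace Summit.Ventures.CertifiedManyBodySolver.Downfold

open Literature.MathematicalPhysics.QuantumLattice
open Matrix HubbardWave0 Literature.Probability.LatticeModels ThermodynamicLimit Filter Topology
open Literature.MathematicalPhysics.QuantumManyBody.StateRelaxation
open Summit.Ventures.CertifiedQuantumChemistry Summit.Ventures.CertifiedQuantumChemistry.CARPoly
open Summit.Ventures.CertifiedManyBodySolver.CARPolyWindow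
open scoped BigOperators ComplexOrder

section KernelPair

variable {α β : Type*} [LinearOrder α]

/-- **KERNEL FORM OF THE WN-FAMILY PAIR NODE‴** (objective family, every filling): the hypotheses of `SquareTTPrimePinnedPairRowT.of_kernelCerts` with
`sl_v = (μ_v 0 + μ_v 1)/2` in place of the filling bounds ⟹ `TPrimePinnedPairFamilyRowWN U s_A s_B cap_A cap_B fl_A fl_B β_A κ_A κ_A′ sl_A β_B κ_B κ_B′ sl_B n₀ X`.
[cite: WangEtAl2024, §III] [cite: JanssonChaykinKeil2008, §3] -/
theorem TPrimePinnedPairFamilyRowWN.of_kernelCerts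
    (U : ℚ) (hU : 0 ≤ U) (n₀ sA sB : ℚ)
    {Λ : Finset (Site 2)} (hΛ : Λ ⊆ Literature.Probability.LatticeModels.box 2 7) (h8 : thicken Λ 1 ⊆ Literature.Probability.LatticeModels.box 2 7)
    (h0 : thicken ({0} : Finset (Site 2)) 1 ⊆ Literature.Probability.LatticeModels.box 2 7) (hz : (0 : Site 2) ∈ Literature.Probability.LatticeModels.box 2 7)
    -- letters (shared)
    (d : α → Orb (PolySite (Literature.Probability.LatticeModels.box 2 7))) (hd : Function.Injective d) (enc : α → ℕ) (Bkey : ℕ)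
    (dΛ : β → Orb (PolySite Λ)) (f : β → α) (hf : ∀ b, d (f b) = Orb.embMap (PolySite.incl hΛ) (dΛ b))
    (sp : α → Fin 2) (hsp : ∀ a, (ofLex (d a)).2 = sp a)
    (o : Fin 2 → α) (ho : ∀ σ, d (o σ) = orb (PolySite.pt 0 hz) σ)
    -- the objective family and the SHARED eom words
    (X : ℝ → FermionOp (Literature.Probability.LatticeModels.box 2 7)) (EB : List (Terms β))
    -- vertex A
    (THA : Terms α) (hHA : termOp d THA = (hubbardTTPrimeFermionInteraction 1 (sA : ℝ) (U : ℝ)).localHamiltonian (Literature.Probability.LatticeModels.box 2 7))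
    (TEA : Terms α)
    (hEA : termOp d TEA = fermionEmbed (PolySite.incl h0) ((hubbardTTPrimeFermionInteraction 1 (sA : ℝ) (U : ℝ)).meanEnergyObs 1))
    (TXA : Terms α) (hXA : termOp d TXA = X (sA : ℝ)) (μA : Fin 2 → ℚ) (νA κA capA κA' flA : ℚ)
    (TGA : Terms α) {mA : Type*} [Fintype mA] [DecidableEq mA] {ΛmA : Matrix mA mA ℂ} (hΛmA : ΛmA.PosSemidef)
    (OA : mA → FermionOp (Literature.Probability.LatticeModels.box 2 7)) (hGA : termOp d TGA = gramForm ΛmA OA)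
    {nSA : ℕ} (γA : Fin nSA → DihedralGroup 4) (wvA : Fin nSA → Site 2) (hshA : ∀ l, d4ShiftSet (γA l) (wvA l) Λ ⊆ Literature.Probability.LatticeModels.box 2 7)
    (gA : Fin nSA → β → α)
    (hgA : ∀ l b, d (gA l b) = Orb.embMap (PolySite.incl (hshA l)) (Orb.embMap (PolySite.d4Emb (γA l) (wvA l) Λ) (dΛ b)))
    (SYA : Fin nSA → Terms β) (CWA : Terms α) (hcwA : ∀ wc ∈ CWA, chargeW wc.1 ≠ 0 ∨ spinChargeW sp wc.1 ≠ 0) (AVA : List (Terms α))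
    {RA : CARPoly.Poly α}
    (hRA : CARPoly.normalize enc Bkey (residTG TXA μA νA o κA capA κA' flA TEA TGA THA f EB gA SYA CWA AVA) = RA)
    {βA : ℚ} (hβA : βA ≤ lowerConst RA + (μA 0 + μA 1) * (n₀ / 2 - νA)) {slA : ℚ} (hslA : slA = (μA 0 + μA 1) / 2)
    -- vertex B
    (THB : Terms α) (hHB : termOp d THB = (hubbardTTPrimeFermionInteraction 1 (sB : ℝ) (U : ℝ)).localHamiltonian (Literature.Probability.LatticeModels.box 2 7))
    (TEB : Terms α)
    (hEB : termOp d TEB = fermionEmbed (PolySite.incl h0) ((hubbardTTPrimeFermionInteraction 1 (sB : ℝ) (U : ℝ)).meanEnergyObs 1))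
    (TXB : Terms α) (hXB : termOp d TXB = X (sB : ℝ)) (μB : Fin 2 → ℚ) (νB κB capB κB' flB : ℚ)
    (TGB : Terms α) {mB : Type*} [Fintype mB] [DecidableEq mB] {ΛmB : Matrix mB mB ℂ} (hΛmB : ΛmB.PosSemidef)
    (OB : mB → FermionOp (Literature.Probability.LatticeModels.box 2 7)) (hGB : termOp d TGB = gramForm ΛmB OB)
    {nSB : ℕ} (γB : Fin nSB → DihedralGroup 4) (wvB : Fin nSB → Site 2) (hshB : ∀ l, d4ShiftSet (γB l) (wvB l) Λ ⊆ Literature.Probability.LatticeModels.box 2 7)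
    (gB : Fin nSB → β → α)
    (hgB : ∀ l b, d (gB l b) = Orb.embMap (PolySite.incl (hshB l)) (Orb.embMap (PolySite.d4Emb (γB l) (wvB l) Λ) (dΛ b)))
    (SYB : Fin nSB → Terms β) (CWB : Terms α) (hcwB : ∀ wc ∈ CWB, chargeW wc.1 ≠ 0 ∨ spinChargeW sp wc.1 ≠ 0) (AVB : List (Terms α))
    {RB : CARPoly.Poly α}
    (hRB : CARPoly.normalize enc Bkey (residTG TXB μB νB o κB capB κB' flB TEB TGB THB f EB gB SYB CWB AVB) = RB)
    {βB : ℚ} (hβB : βB ≤ lowerConst RB + (μB 0 + μB 1) * (n₀ / 2 - νB)) {slB : ℚ} (hslB : slB = (μB 0 + μB 1) / 2) :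
    TPrimePinnedPairFamilyRowWN (U : ℝ) (sA : ℝ) (sB : ℝ) capA capB flA flB βA κA κA' slA βB κB κB' slB n₀ X := by
  have hUr : (0 : ℝ) ≤ ((U : ℚ) : ℝ) := by exact_mod_cast hU
  -- (1) the two window identities, on the objectives `X sA`, `X sB`
  have hcertA := windowIdentity_of_residTG hΛ hz d hd enc Bkey dΛ f hf THA _ hHA TEA _ hEA o ho TXA μA νA κA capA κA' flA TGA
    ΛmA OA hGA EB γA wvA hshA gA hgA SYA CWA AVA hRA
  rw [hXA] at hcertA
  have hcertB := windowIdentity_of_residTG hΛ hz d hd enc Bkey dΛ f hf THB _ hHB TEB _ hEB o ho TXB μB νB κB capB κB' flB TGB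
    ΛmB OB hGB EB γB wvB hshB gB hgB SYB CWB AVB hRB
  rw [hXB] at hcertB
  -- (2) the charged words are charged (decided on the syntax)
  have hcwA' := charged_of_hcw d sp hsp CWA hcwA
  have hcwB' := charged_of_hcw d sp hsp CWB hcwB
  -- (3) the prices are the engine's `lowerConst`; the filling slopes are half the density multipliers
  have hβA' : ((βA : ℚ) : ℝ) ≤ ((constCoeff RA : ℚ) : ℝ) - ∑ k ∈ (Finset.univ : Finset (Fin RA.length)), ‖resCoeff RA k‖ +
      (∑ σ : Fin 2, ((μA σ : ℚ) : ℝ)) * (((n₀ : ℚ) : ℝ) / 2 - ((νA : ℚ) : ℝ)) := by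
    rw [constCoeff_sub_sum_norm_resCoeff RA, Fin.sum_univ_two]
    have h2 : ((βA : ℚ) : ℝ) ≤ (((lowerConst RA + (μA 0 + μA 1) * (n₀ / 2 - νA) : ℚ)) : ℝ) := by exact_mod_cast hβA
    push_cast at h2
    linarith
  have hβB' : ((βB : ℚ) : ℝ) ≤ ((constCoeff RB : ℚ) : ℝ) - ∑ k ∈ (Finset.univ : Finset (Fin RB.length)), ‖resCoeff RB k‖ +
      (∑ σ : Fin 2, ((μB σ : ℚ) : ℝ)) * (((n₀ : ℚ) : ℝ) / 2 - ((νB : ℚ) : ℝ)) := by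
    rw [constCoeff_sub_sum_norm_resCoeff RB, Fin.sum_univ_two]
    have h2 : ((βB : ℚ) : ℝ) ≤ (((lowerConst RB + (μB 0 + μB 1) * (n₀ / 2 - νB) : ℚ)) : ℝ) := by exact_mod_cast hβB
    push_cast at h2
    linarith
  have hslA' : ((slA : ℚ) : ℝ) = (∑ σ : Fin 2, ((μA σ : ℚ) : ℝ)) / 2 := by
    rw [Fin.sum_univ_two, hslA]; push_cast; ring
  have hslB' : ((slB : ℚ) : ℝ) = (∑ σ : Fin 2, ((μB σ : ℚ) : ℝ)) / 2 := by
    rw [Fin.sum_univ_two, hslB]; push_cast; ring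
  -- (4) the identity-level pair theorem (density-affine family edition), with the SHARED eom words `B_k := termOp dΛ (EB.get k)`
  exact TPrimePinnedPairFamilyRowWN.of_window_certificates hUr X hΛ h8 h0 hz
    (Finset.univ : Finset (Fin EB.length)) (fun k => termOp dΛ (EB.get k))
    (fun σ => ((μA σ : ℚ) : ℝ)) ((νA : ℚ) : ℝ) hΛmA OA Finset.univ γA wvA hshA (fun l => termOp dΛ (SYA l))
    Finset.univ (fun j => (((CWA.get j).2 : ℚ) : ℂ)) (fun j => wmap d (CWA.get j).1) hcwA' Finset.univ (fun _ => (1 : ℝ))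
    (fun m' => termOp d (AVA.get m')) Finset.univ (resCoeff RA) (resWord d RA) hcertA hβA' hslA'
    (fun σ => ((μB σ : ℚ) : ℝ)) ((νB : ℚ) : ℝ) hΛmB OB Finset.univ γB wvB hshB (fun l => termOp dΛ (SYB l))
    Finset.univ (fun j => (((CWB.get j).2 : ℚ) : ℂ)) (fun j => wmap d (CWB.get j).1) hcwB' Finset.univ (fun _ => (1 : ℝ))
    (fun m' => termOp d (AVB.get m')) Finset.univ (resCoeff RB) (resWord d RB) hcertB hβB' hslB'

end KernelPair

/-! ## The SOS-factor (`gramT`) editions: hubbard-obs-p2's `residT` data verbatim, twice, with ONE shared `EB` -/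

section KernelPairSOS

variable {α β : Type*} [LinearOrder α]

/-- **KERNEL FORM OF THE WN-FAMILY PAIR NODE‴, SOS-FACTOR GRAM (`residT` edition).** [cite: WangEtAl2024, §III] [cite: JanssonChaykinKeil2008, §3] -/
theorem TPrimePinnedPairFamilyRowWN.of_kernelCerts_sos
    (U : ℚ) (hU : 0 ≤ U) (n₀ sA sB : ℚ)
    {Λ : Finset (Site 2)} (hΛ : Λ ⊆ Literature.Probability.LatticeModels.box 2 7) (h8 : thicken Λ 1 ⊆ Literature.Probability.LatticeModels.box 2 7)
    (h0 : thicken ({0} : Finset (Site 2)) 1 ⊆ Literature.Probability.LatticeModels.box 2 7) (hz : (0 : Site 2) ∈ Literature.Probability.LatticeModels.box 2 7)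
    (d : α → Orb (PolySite (Literature.Probability.LatticeModels.box 2 7))) (hd : Function.Injective d) (enc : α → ℕ) (Bkey : ℕ)
    (dΛ : β → Orb (PolySite Λ)) (f : β → α) (hf : ∀ b, d (f b) = Orb.embMap (PolySite.incl hΛ) (dΛ b))
    (sp : α → Fin 2) (hsp : ∀ a, (ofLex (d a)).2 = sp a)
    (o : Fin 2 → α) (ho : ∀ σ, d (o σ) = orb (PolySite.pt 0 hz) σ)
    (X : ℝ → FermionOp (Literature.Probability.LatticeModels.box 2 7)) (EB : List (Terms β))
    -- vertex A
    (THA : Terms α) (hHA : termOp d THA = (hubbardTTPrimeFermionInteraction 1 (sA : ℝ) (U : ℝ)).localHamiltonian (Literature.Probability.LatticeModels.box 2 7))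
    (TEA : Terms α)
    (hEA : termOp d TEA = fermionEmbed (PolySite.incl h0) ((hubbardTTPrimeFermionInteraction 1 (sA : ℝ) (U : ℝ)).meanEnergyObs 1))
    (TXA : Terms α) (hXA : termOp d TXA = X (sA : ℝ)) (μA : Fin 2 → ℚ) (νA κA capA κA' flA : ℚ) (KA : ℕ) (QA : List (Terms α))
    {nSA : ℕ} (γA : Fin nSA → DihedralGroup 4) (wvA : Fin nSA → Site 2) (hshA : ∀ l, d4ShiftSet (γA l) (wvA l) Λ ⊆ Literature.Probability.LatticeModels.box 2 7)
    (gA : Fin nSA → β → α)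
    (hgA : ∀ l b, d (gA l b) = Orb.embMap (PolySite.incl (hshA l)) (Orb.embMap (PolySite.d4Emb (γA l) (wvA l) Λ) (dΛ b)))
    (SYA : Fin nSA → Terms β) (CWA : Terms α) (hcwA : ∀ wc ∈ CWA, chargeW wc.1 ≠ 0 ∨ spinChargeW sp wc.1 ≠ 0) (AVA : List (Terms α))
    {RA : CARPoly.Poly α}
    (hRA : CARPoly.normalize enc Bkey (residT TXA μA νA o κA capA κA' flA TEA KA QA THA f EB gA SYA CWA AVA) = RA)
    {βA : ℚ} (hβA : βA ≤ lowerConst RA + (μA 0 + μA 1) * (n₀ / 2 - νA)) {slA : ℚ} (hslA : slA = (μA 0 + μA 1) / 2)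
    -- vertex B
    (THB : Terms α) (hHB : termOp d THB = (hubbardTTPrimeFermionInteraction 1 (sB : ℝ) (U : ℝ)).localHamiltonian (Literature.Probability.LatticeModels.box 2 7))
    (TEB : Terms α)
    (hEB : termOp d TEB = fermionEmbed (PolySite.incl h0) ((hubbardTTPrimeFermionInteraction 1 (sB : ℝ) (U : ℝ)).meanEnergyObs 1))
    (TXB : Terms α) (hXB : termOp d TXB = X (sB : ℝ)) (μB : Fin 2 → ℚ) (νB κB capB κB' flB : ℚ) (KB : ℕ) (QB : List (Terms α))
    {nSB : ℕ} (γB : Fin nSB → DihedralGroup 4) (wvB : Fin nSB → Site 2) (hshB : ∀ l, d4ShiftSet (γB l) (wvB l) Λ ⊆ Literature.Probability.LatticeModels.box 2 7)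
    (gB : Fin nSB → β → α)
    (hgB : ∀ l b, d (gB l b) = Orb.embMap (PolySite.incl (hshB l)) (Orb.embMap (PolySite.d4Emb (γB l) (wvB l) Λ) (dΛ b)))
    (SYB : Fin nSB → Terms β) (CWB : Terms α) (hcwB : ∀ wc ∈ CWB, chargeW wc.1 ≠ 0 ∨ spinChargeW sp wc.1 ≠ 0) (AVB : List (Terms α))
    {RB : CARPoly.Poly α}
    (hRB : CARPoly.normalize enc Bkey (residT TXB μB νB o κB capB κB' flB TEB KB QB THB f EB gB SYB CWB AVB) = RB)
    {βB : ℚ} (hβB : βB ≤ lowerConst RB + (μB 0 + μB 1) * (n₀ / 2 - νB)) {slB : ℚ} (hslB : slB = (μB 0 + μB 1) / 2) :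
    TPrimePinnedPairFamilyRowWN (U : ℝ) (sA : ℝ) (sB : ℝ) capA capB flA flB βA κA κA' slA βB κB κB' slB n₀ X :=
  TPrimePinnedPairFamilyRowWN.of_kernelCerts U hU n₀ sA sB hΛ h8 h0 hz d hd enc Bkey dΛ f hf sp hsp o ho X EB
    THA hHA TEA hEA TXA hXA μA νA κA capA κA' flA (gramT KA QA) (posSemidef_one_fin QA.length) (gramOp d KA QA)
    (termOp_gramT_eq_gramForm d KA QA) γA wvA hshA gA hgA SYA CWA hcwA AVA hRA hβA hslA
    THB hHB TEB hEB TXB hXB μB νB κB capB κB' flB (gramT KB QB) (posSemidef_one_fin QB.length) (gramOp d KB QB)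
    (termOp_gramT_eq_gramForm d KB QB) γB wvB hshB gB hgB SYB CWB hcwB AVB hRB hβB hslB

/-- **KERNEL FORM OF THE CONSTANT-OBJECTIVE WN PAIR NODE‴ (`TPrimePinnedPairRowWN … X₀`), SOS-FACTOR GRAM** — both certificates bound the SAME word
`X₀` (`termOp d TX_v = X₀`); every NdNiO₂ `…pairs_ABC_P` pair and La214 M2(c) `Po`. [cite: WangEtAl2024, §III] [cite: JanssonChaykinKeil2008, §3] -/
theorem TPrimePinnedPairRowWN.of_kernelCerts_sos
    (U : ℚ) (hU : 0 ≤ U) (n₀ sA sB : ℚ)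
    {Λ : Finset (Site 2)} (hΛ : Λ ⊆ Literature.Probability.LatticeModels.box 2 7) (h8 : thicken Λ 1 ⊆ Literature.Probability.LatticeModels.box 2 7)
    (h0 : thicken ({0} : Finset (Site 2)) 1 ⊆ Literature.Probability.LatticeModels.box 2 7) (hz : (0 : Site 2) ∈ Literature.Probability.LatticeModels.box 2 7)
    (d : α → Orb (PolySite (Literature.Probability.LatticeModels.box 2 7))) (hd : Function.Injective d) (enc : α → ℕ) (Bkey : ℕ)
    (dΛ : β → Orb (PolySite Λ)) (f : β → α) (hf : ∀ b, d (f b) = Orb.embMap (PolySite.incl hΛ) (dΛ b))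
    (sp : α → Fin 2) (hsp : ∀ a, (ofLex (d a)).2 = sp a)
    (o : Fin 2 → α) (ho : ∀ σ, d (o σ) = orb (PolySite.pt 0 hz) σ)
    (X₀ : FermionOp (Literature.Probability.LatticeModels.box 2 7)) (EB : List (Terms β))
    -- vertex A
    (THA : Terms α) (hHA : termOp d THA = (hubbardTTPrimeFermionInteraction 1 (sA : ℝ) (U : ℝ)).localHamiltonian (Literature.Probability.LatticeModels.box 2 7))
    (TEA : Terms α)
    (hEA : termOp d TEA = fermionEmbed (PolySite.incl h0) ((hubbardTTPrimeFermionInteraction 1 (sA : ℝ) (U : ℝ)).meanEnergyObs 1))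
    (TXA : Terms α) (hXA : termOp d TXA = X₀) (μA : Fin 2 → ℚ) (νA κA capA κA' flA : ℚ) (KA : ℕ) (QA : List (Terms α))
    {nSA : ℕ} (γA : Fin nSA → DihedralGroup 4) (wvA : Fin nSA → Site 2) (hshA : ∀ l, d4ShiftSet (γA l) (wvA l) Λ ⊆ Literature.Probability.LatticeModels.box 2 7)
    (gA : Fin nSA → β → α)
    (hgA : ∀ l b, d (gA l b) = Orb.embMap (PolySite.incl (hshA l)) (Orb.embMap (PolySite.d4Emb (γA l) (wvA l) Λ) (dΛ b)))
    (SYA : Fin nSA → Terms β) (CWA : Terms α) (hcwA : ∀ wc ∈ CWA, chargeW wc.1 ≠ 0 ∨ spinChargeW sp wc.1 ≠ 0) (AVA : List (Terms α))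
    {RA : CARPoly.Poly α}
    (hRA : CARPoly.normalize enc Bkey (residT TXA μA νA o κA capA κA' flA TEA KA QA THA f EB gA SYA CWA AVA) = RA)
    {βA : ℚ} (hβA : βA ≤ lowerConst RA + (μA 0 + μA 1) * (n₀ / 2 - νA)) {slA : ℚ} (hslA : slA = (μA 0 + μA 1) / 2)
    -- vertex B
    (THB : Terms α) (hHB : termOp d THB = (hubbardTTPrimeFermionInteraction 1 (sB : ℝ) (U : ℝ)).localHamiltonian (Literature.Probability.LatticeModels.box 2 7))
    (TEB : Terms α)
    (hEB : termOp d TEB = fermionEmbed (PolySite.incl h0) ((hubbardTTPrimeFermionInteraction 1 (sB : ℝ) (U : ℝ)).meanEnergyObs 1))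
    (TXB : Terms α) (hXB : termOp d TXB = X₀) (μB : Fin 2 → ℚ) (νB κB capB κB' flB : ℚ) (KB : ℕ) (QB : List (Terms α))
    {nSB : ℕ} (γB : Fin nSB → DihedralGroup 4) (wvB : Fin nSB → Site 2) (hshB : ∀ l, d4ShiftSet (γB l) (wvB l) Λ ⊆ Literature.Probability.LatticeModels.box 2 7)
    (gB : Fin nSB → β → α)
    (hgB : ∀ l b, d (gB l b) = Orb.embMap (PolySite.incl (hshB l)) (Orb.embMap (PolySite.d4Emb (γB l) (wvB l) Λ) (dΛ b)))
    (SYB : Fin nSB → Terms β) (CWB : Terms α) (hcwB : ∀ wc ∈ CWB, chargeW wc.1 ≠ 0 ∨ spinChargeW sp wc.1 ≠ 0) (AVB : List (Terms α))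
    {RB : CARPoly.Poly α}
    (hRB : CARPoly.normalize enc Bkey (residT TXB μB νB o κB capB κB' flB TEB KB QB THB f EB gB SYB CWB AVB) = RB)
    {βB : ℚ} (hβB : βB ≤ lowerConst RB + (μB 0 + μB 1) * (n₀ / 2 - νB)) {slB : ℚ} (hslB : slB = (μB 0 + μB 1) / 2) :
    TPrimePinnedPairRowWN (U : ℝ) (sA : ℝ) (sB : ℝ) capA capB flA flB βA κA κA' slA βB κB κB' slB n₀ X₀ :=
  (TPrimePinnedPairRowWN_iff_family).2
    (TPrimePinnedPairFamilyRowWN.of_kernelCerts_sos U hU n₀ sA sB hΛ h8 h0 hz d hd enc Bkey dΛ f hf sp hsp o ho (fun _ => X₀) EB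
      THA hHA TEA hEA TXA hXA μA νA κA capA κA' flA KA QA γA wvA hshA gA hgA SYA CWA hcwA AVA hRA hβA hslA
      THB hHB TEB hEB TXB hXB μB νB κB capB κB' flB KB QB γB wvB hshB gB hgB SYB CWB hcwB AVB hRB hβB hslB)

end KernelPairSOS

end Summit.Ventures.CertifiedManyBodySolver.Downfold

end
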